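import Mathlib
import Literature.NumberTheory.Irrationality.Zudilin2003.CatalanRemarks
import HarnessLib

/-!
# Catalan box family — Zudilin's SECOND recursion (13): exact `2`-adic valuations of `ũ_n` and `ṽ_n`

HONEST FRAMING: systematic search; no irrationality claim unless certified.  Arithmetic of two explicitly defined rational
sequences; nothing here is a statement about Catalan's constant.

Cell `pub-zeta5`, planner seat `fam-catalan` (gen 7), Part C of the kernel target K-uT.  Zudilin, *A few remarks on linear forms
involving Catalan's constant*, arXiv:math/0210423, Theorem 2, defines `ũ_n`, `ṽ_n` (tree: `Zudilin2003.uT`, `Zudilin2003.vT`) as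
the solutions of the Apéry-like recursion (13) with `ũ₀ = 0, ũ₁ = 6`, `ṽ₀ = −1, ṽ₁ = 5`, and states the inclusions (14)
`2^{4n+o(n)} ũ_n ∈ ℤ`, `2^{4n+o(n)} D²_{2n−1} ṽ_n ∈ ℤ` (clause (iii) of the UNPROVED named fact `Zudilin2003.remarksTheorem2`).
This file runs the cell's ultrametric induction (the pattern of `Zudilin2003.TwoAdic.padicValRat_two_u/v` for the FIRST
recursion, file `CatalanTwoAdic.lean`) along (13): the extreme coefficients `(2n)²(2n+1)²p̃(n)` and
`(2n)²(2n+1)(2n−3)p̃(n+1)` both have `2`-adic valuation `2 + 2v₂(n)` and the middle one `q̃(n)` is odd, so the valuation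
drops by exactly `2 + 2v₂(n)` at each step:
* `padicValRat_solT_succ` — for ANY solution `x = solT x₀ x₁` of (13) with `x_{m+1} > 0` for all `m`, `v₂(x₁) = c` and
  `v₂(x₂) = c − 2`: `v₂(x_{m+1}) = c − 2m − 2v₂(m!)`;
* `padicValRat_two_uT_succ` : `v₂(ũ_{m+1}) = 1 − 2m − 2v₂(m!)`, `padicValRat_two_vT_succ` : `v₂(ṽ_{m+1}) = −2m − 2v₂(m!)`
  (so `v₂(ṽ_{m+1}) = v₂(u_m)` of the first recursion and `v₂(ũ_{m+1}) = v₂(u_m) + 1`);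
* `padicValRat_vT` : `v₂(ṽ_n) = 4 − 4n + 2s₂(n−1)` for `n ≥ 1` (Legendre; `s₂` = binary digit sum),
  `padicValNat_two_den_vT` : the `2`-part of `den ṽ_n` is EXACTLY `2^{4n−4−2s₂(n−1)}`, and
  `vT_twoPart_odd_den` : `2^{4n−4} ṽ_n` has ODD reduced denominator for every `n ≥ 1` — the `2`-PART of the `ṽ`-inclusion (14)
  with exponent `4n − 4 ≤ 4n` instead of `4n + o(n)`.  The ODD part (`D²_{2n−1}`) of that inclusion is NOT addressed (it is
  invisible to the recursion; in print it comes from the partial fractions of the series (12), cf. how `Remarks.v_int_odd_part`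
  treats the first construction in `CatalanRemarksTheorem1.lean`);
* positivity `uT_succ_pos`, `vT_succ_pos` (needed by the ultrametric step; from `ũ₁, ũ₂, ṽ₁, ṽ₂ > 0` and the positivity of all
  coefficients of the solved recursion from `n = 2` on).
Independent of the companion files `CatalanRemarksUT` / `CatalanRemarksUTDenominator` (which identify `ũ_n` as a box value and
give `den ũ_n = 2^{4n−5−2s₂(n−1)}` with NO odd part); `padicValRat_two_uT_succ` is a second, recursion-route proof of their
valuation.  Exact cross-check of both valuation laws for `n ≤ 300`: seat folder `kV/check_vT.py`.
-/

namespace Summit.KontsevichZagierPeriods.Zeta5Search.CatalanRemarksTwoAdic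

open Literature.NumberTheory.Irrationality.Zudilin2003
  (pT qT IsSolutionT stepT solT uT vT pT_pos leadT_pos solT_step solT_isSolutionT uT_two vT_two)

/-! ### `2`-adic valuations of the coefficients of (13) -/

/-- An odd integer has `2`-adic valuation `0` (as a rational). -/
private theorem padicValRat_two_oddInt (z : ℤ) (hz : Odd z) : padicValRat 2 (z : ℚ) = 0 := by
  rw [padicValRat.of_int]
  have : ¬ (2 : ℤ) ∣ z := by
    rintro ⟨c, hc⟩
    obtain ⟨r, hr⟩ := hz
    omega
  simp [padicValInt.eq_zero_of_not_dvd this]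

/-- `v₂(2) = 1`. -/
private theorem padicValRat_two_two' : padicValRat 2 (2 : ℚ) = 1 := by
  simpa using (padicValRat.self (p := 2) one_lt_two)

/-- `v₂(2m) = 1 + v₂(m)` for `m ≠ 0` (as rationals). -/
private theorem padicValRat_two_twice (m : ℕ) (hm : m ≠ 0) :
    padicValRat 2 ((2 * m : ℕ) : ℚ) = 1 + padicValNat 2 m := by
  rw [padicValRat.of_nat, padicValNat.mul (by norm_num) hm, padicValNat_self]
  push_cast
  ring

/-- The middle coefficient `q̃(n) = 3520n⁶ − 2672n⁴ + 196n² − 9` of (13) is odd: `v₂(q̃(n)) = 0`. -/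
theorem padicValRat_two_qT (n : ℕ) : padicValRat 2 (qT (n : ℚ)) = 0 := by
  have h : qT (n : ℚ) = ((2 * (1760 * (n : ℤ) ^ 6 - 1336 * n ^ 4 + 98 * n ^ 2 - 5) + 1 : ℤ) : ℚ) := by
    unfold qT; push_cast; ring
  rw [h]
  exact padicValRat_two_oddInt _ ⟨_, rfl⟩

/-- `p̃(n) = 20n² − 20n + 3` is odd: `v₂(p̃(n)) = 0`. -/
theorem padicValRat_two_pT (n : ℤ) : padicValRat 2 (pT (n : ℚ)) = 0 := by
  have h : pT (n : ℚ) = ((2 * (10 * n ^ 2 - 10 * n + 1) + 1 : ℤ) : ℚ) := by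
    unfold pT; push_cast; ring
  rw [h]
  exact padicValRat_two_oddInt _ ⟨_, rfl⟩

/-- The leading coefficient of (13): `v₂((2n)²(2n+1)²p̃(n)) = 2 + 2v₂(n)` (`n ≥ 1`). -/
theorem padicValRat_two_leadT {n : ℕ} (hn : 1 ≤ n) :
    padicValRat 2 ((2 * (n : ℚ)) ^ 2 * (2 * (n : ℚ) + 1) ^ 2 * pT (n : ℚ)) = 2 + 2 * padicValNat 2 n := by
  have h1 : (2 * (n : ℚ)) ≠ 0 := by
    have : (1 : ℚ) ≤ n := by exact_mod_cast hn
    positivity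
  have h2 : (2 * (n : ℚ) + 1) ≠ 0 := by positivity
  have h3 : pT (n : ℚ) ≠ 0 := (pT_pos n).ne'
  rw [padicValRat.mul (mul_ne_zero (pow_ne_zero 2 h1) (pow_ne_zero 2 h2)) h3,
    padicValRat.mul (pow_ne_zero 2 h1) (pow_ne_zero 2 h2), padicValRat.pow, padicValRat.pow,
    show (2 * (n : ℚ) + 1) = ((2 * (n : ℤ) + 1 : ℤ) : ℚ) by push_cast; ring,
    padicValRat_two_oddInt _ ⟨n, rfl⟩,
    show (2 * (n : ℚ)) = ((2 * n : ℕ) : ℚ) by push_cast; ring, padicValRat_two_twice n (by omega),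
    show (n : ℚ) = ((n : ℤ) : ℚ) by simp, padicValRat_two_pT]
  push_cast
  ring

/-- The trailing coefficient of (13): `v₂((2n)²(2n+1)(2n−3)p̃(n+1)) = 2 + 2v₂(n)` (`n ≥ 1`). -/
theorem padicValRat_two_tailT {n : ℕ} (hn : 1 ≤ n) :
    padicValRat 2 ((2 * (n : ℚ)) ^ 2 * (2 * (n : ℚ) + 1) * (2 * (n : ℚ) - 3) * pT ((n : ℚ) + 1))
      = 2 + 2 * padicValNat 2 n := by
  have h1 : (2 * (n : ℚ)) ≠ 0 := by
    have : (1 : ℚ) ≤ n := by exact_mod_cast hn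
    positivity
  have h2 : (2 * (n : ℚ) + 1) ≠ 0 := by positivity
  have h3 : (2 * (n : ℚ) - 3) ≠ 0 := by
    intro h
    have h' : (2 * n : ℕ) = 3 := by exact_mod_cast (show (2 * (n : ℚ)) = 3 by linarith)
    omega
  have h4 : pT ((n : ℚ) + 1) ≠ 0 := by
    have := pT_pos (n + 1)
    push_cast at this
    exact this.ne'
  rw [padicValRat.mul (mul_ne_zero (mul_ne_zero (pow_ne_zero 2 h1) h2) h3) h4,
    padicValRat.mul (mul_ne_zero (pow_ne_zero 2 h1) h2) h3, padicValRat.mul (pow_ne_zero 2 h1) h2, padicValRat.pow,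
    show (2 * (n : ℚ) + 1) = ((2 * (n : ℤ) + 1 : ℤ) : ℚ) by push_cast; ring,
    padicValRat_two_oddInt _ ⟨n, rfl⟩,
    show (2 * (n : ℚ) - 3) = ((2 * ((n : ℤ) - 2) + 1 : ℤ) : ℚ) by push_cast; ring,
    padicValRat_two_oddInt _ ⟨(n : ℤ) - 2, rfl⟩,
    show (2 * (n : ℚ)) = ((2 * n : ℕ) : ℚ) by push_cast; ring, padicValRat_two_twice n (by omega),
    show (n : ℚ) + 1 = (((n : ℤ) + 1 : ℤ) : ℚ) by push_cast; ring, padicValRat_two_pT]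
  push_cast
  ring

/-! ### Positivity -/

/-- `q̃(t) > 0` for `t ≥ 1` (`q̃(1+s)` has nonnegative coefficients in `s`, constant term `q̃(1) = 1035`). -/
theorem qT_pos_of_one_le {t : ℚ} (ht : 1 ≤ t) : 0 < qT t := by
  obtain ⟨s, hs, rfl⟩ : ∃ s : ℚ, 0 ≤ s ∧ t = s + 1 := ⟨t - 1, by linarith, by ring⟩
  rw [show qT (s + 1) = 3520 * s ^ 6 + 21120 * s ^ 5 + 50128 * s ^ 4 + 59712 * s ^ 3 + 36964 * s ^ 2
      + 10824 * s + 1035 by unfold qT; ring]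
  positivity

/-- `p̃(t) > 0` for `t ≥ 1` (`p̃(1+s) = 20s² + 20s + 3`). -/
theorem pT_pos_of_one_le {t : ℚ} (ht : 1 ≤ t) : 0 < pT t := by
  obtain ⟨s, hs, rfl⟩ : ∃ s : ℚ, 0 ≤ s ∧ t = s + 1 := ⟨t - 1, by linarith, by ring⟩
  rw [show pT (s + 1) = 20 * s ^ 2 + 20 * s + 3 by unfold pT; ring]
  positivity

/-- A solution `solT x₀ x₁` of (13) with `x₁ > 0` and `x₂ > 0` is positive from index `1` on: from `n = 2` on, (13) solved
for `x_{n+1}` has positive coefficients (`2n − 3 > 0`). -/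
theorem solT_succ_pos (x₀ x₁ : ℚ) (h1 : 0 < x₁) (h2 : 0 < solT x₀ x₁ 2) (m : ℕ) : 0 < solT x₀ x₁ (m + 1) := by
  suffices H : ∀ m : ℕ, 0 < solT x₀ x₁ (m + 1) ∧ 0 < solT x₀ x₁ (m + 2) from (H m).1
  intro m
  induction m with
  | zero => exact ⟨by simpa using h1, h2⟩
  | succ m ih =>
    obtain ⟨ha, hb⟩ := ih
    refine ⟨hb, ?_⟩
    rw [show m + 1 + 2 = (m + 1) + 2 by ring, solT_step]
    unfold stepT
    set a := solT x₀ x₁ (m + 1) with ha_def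
    set b := solT x₀ x₁ (m + 1 + 1) with hb_def
    have hb' : 0 < b := by rw [hb_def]; exact hb
    set t : ℚ := ((m + 1 : ℕ) : ℚ) + 1 with ht
    have ht2 : 2 ≤ t := by rw [ht]; push_cast; linarith
    have ht0 : 0 < t := by linarith
    have hq : 0 < qT t := qT_pos_of_one_le (by linarith)
    have hp1 : 0 < pT t := pT_pos_of_one_le (by linarith)
    have hp2 : 0 < pT (t + 1) := pT_pos_of_one_le (by linarith)
    have h3 : 0 < 2 * t - 3 := by linarith
    positivity

/-- `ũ_{m+1} > 0` for every `m` (`ũ₁ = 6`, `ũ₂ = 115/2`). -/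
theorem uT_succ_pos (m : ℕ) : 0 < uT (m + 1) :=
  solT_succ_pos 0 6 (by norm_num) (by rw [show solT 0 6 2 = uT 2 from rfl, uT_two]; norm_num) m

/-- `ṽ_{m+1} > 0` for every `m` (`ṽ₁ = 5`, `ṽ₂ = 1897/36`; note `ṽ₀ = −1`). -/
theorem vT_succ_pos (m : ℕ) : 0 < vT (m + 1) :=
  solT_succ_pos (-1) 5 (by norm_num) (by rw [show solT (-1) 5 2 = vT 2 from rfl, vT_two]; norm_num) m

/-! ### The ultrametric induction along (13) -/

/-- One step of (13) solved for `x_{n+1}` (`n ≥ 2`, so that all coefficients are positive): if `x_{n−1}, x_n > 0` and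
`v₂(x_n) < 2 + 2v₂(n) + v₂(x_{n−1})`, then `v₂(x_{n+1}) = v₂(x_n) − 2 − 2v₂(n)`. -/
theorem stepT_padicValRat (x : ℕ → ℚ) (hx : IsSolutionT x) {n : ℕ} (hn : 2 ≤ n) (h0 : 0 < x (n - 1))
    (h1 : 0 < x n) (hval : padicValRat 2 (x n) < 2 + 2 * padicValNat 2 n + padicValRat 2 (x (n - 1))) :
    padicValRat 2 (x (n + 1)) = padicValRat 2 (x n) - 2 - 2 * padicValNat 2 n := by
  have hrec := hx n (by omega)
  set L := (2 * (n : ℚ)) ^ 2 * (2 * (n : ℚ) + 1) ^ 2 * pT (n : ℚ) with hL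
  set T := (2 * (n : ℚ)) ^ 2 * (2 * (n : ℚ) + 1) * (2 * (n : ℚ) - 3) * pT ((n : ℚ) + 1) with hT
  have hLpos : 0 < L := leadT_pos (by omega)
  have hn2 : (2 : ℚ) ≤ n := by exact_mod_cast hn
  have hTpos : 0 < T := by
    have hp : 0 < pT ((n : ℚ) + 1) := pT_pos_of_one_le (by linarith)
    have h3 : 0 < (2 * (n : ℚ) - 3) := by linarith
    positivity
  have hqpos : 0 < qT (n : ℚ) := qT_pos_of_one_le (by linarith)
  have hx1 : x (n + 1) = (qT (n : ℚ) * x n + T * x (n - 1)) / L := by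
    rw [eq_div_iff hLpos.ne']
    linear_combination hrec
  have hA : padicValRat 2 (qT (n : ℚ) * x n) = padicValRat 2 (x n) := by
    rw [padicValRat.mul hqpos.ne' h1.ne', padicValRat_two_qT, zero_add]
  have hB : padicValRat 2 (T * x (n - 1)) = 2 + 2 * padicValNat 2 n + padicValRat 2 (x (n - 1)) := by
    rw [padicValRat.mul hTpos.ne' h0.ne', hT, padicValRat_two_tailT (by omega)]
  have hsum : padicValRat 2 (qT (n : ℚ) * x n + T * x (n - 1)) = padicValRat 2 (x n) := by
    rw [padicValRat.add_eq_of_lt (by positivity) (by positivity) (by positivity) (by rw [hA, hB]; exact hval), hA]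
  rw [hx1, padicValRat.div (by positivity) hLpos.ne', hsum, hL, padicValRat_two_leadT (by omega)]
  ring

/-- `v₂((m+1)!) = v₂(m!) + v₂(m+1)`. -/
private theorem padicValNat_factorial_succ' (m : ℕ) :
    padicValNat 2 (m + 1).factorial = padicValNat 2 m.factorial + padicValNat 2 (m + 1) := by
  rw [Nat.factorial_succ, padicValNat.mul (by omega) (Nat.factorial_ne_zero m), add_comm]

/-- **The valuation law along (13).**  For any solution `x = solT x₀ x₁` which is positive from index `1` on, with
`v₂(x₁) = c` and `v₂(x₂) = c − 2`: `v₂(x_{m+1}) = c − 2m − 2v₂(m!)` for every `m`. -/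
theorem padicValRat_solT_succ (x₀ x₁ : ℚ) (c : ℤ) (hpos : ∀ m : ℕ, 0 < solT x₀ x₁ (m + 1))
    (hv1 : padicValRat 2 x₁ = c) (hv2 : padicValRat 2 (solT x₀ x₁ 2) = c - 2) (m : ℕ) :
    padicValRat 2 (solT x₀ x₁ (m + 1)) = c - 2 * (m : ℤ) - 2 * padicValNat 2 m.factorial := by
  suffices H : ∀ m : ℕ, padicValRat 2 (solT x₀ x₁ (m + 1)) = c - 2 * (m : ℤ) - 2 * padicValNat 2 m.factorial
      ∧ padicValRat 2 (solT x₀ x₁ (m + 2)) = c - 2 * ((m : ℤ) + 1) - 2 * padicValNat 2 (m + 1).factorial from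
    (H m).1
  intro m
  induction m with
  | zero =>
    refine ⟨by simpa using hv1, ?_⟩
    rw [hv2]
    simp
  | succ m ih =>
    obtain ⟨h0, h1⟩ := ih
    refine ⟨by rw [h1]; push_cast; ring, ?_⟩
    have hfs := padicValNat_factorial_succ' m
    have hfs' := padicValNat_factorial_succ' (m + 1)
    have hstep := stepT_padicValRat (solT x₀ x₁) (solT_isSolutionT x₀ x₁) (n := m + 2) (by omega)
      (by simpa using hpos m) (hpos (m + 1))
      (by
        rw [show m + 2 - 1 = m + 1 from rfl, h0, h1]
        omega)
    have hfs2 : padicValNat 2 (m + 2).factorial = padicValNat 2 (m + 1).factorial + padicValNat 2 (m + 2) := hfs'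
    rw [show m + 1 + 2 = (m + 2) + 1 from rfl, show m + 1 + 1 = m + 2 from rfl, hstep, h1, hfs2]
    omega

/-- **`v₂(ũ_{m+1}) = 1 − 2m − 2v₂(m!)`** (`ũ₁ = 6 = 2·3`, `ũ₂ = 115/2`). -/
theorem padicValRat_two_uT_succ (m : ℕ) :
    padicValRat 2 (uT (m + 1)) = 1 - 2 * (m : ℤ) - 2 * padicValNat 2 m.factorial := by
  have h6 : padicValRat 2 (6 : ℚ) = 1 := by
    rw [show (6 : ℚ) = 2 * ((3 : ℤ) : ℚ) by norm_num, padicValRat.mul two_ne_zero (by norm_num), padicValRat_two_two',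
      padicValRat_two_oddInt 3 ⟨1, by norm_num⟩]
    simp
  have h2 : padicValRat 2 (uT 2) = 1 - 2 := by
    rw [uT_two, padicValRat.div (by norm_num) two_ne_zero, show (115 : ℚ) = ((115 : ℤ) : ℚ) by norm_num,
      padicValRat_two_oddInt 115 ⟨57, by norm_num⟩, padicValRat_two_two']
    norm_num
  have h := padicValRat_solT_succ 0 6 1 uT_succ_pos h6 h2 m
  rw [show uT (m + 1) = solT 0 6 (m + 1) from rfl, h]

/-- **`v₂(ṽ_{m+1}) = −2m − 2v₂(m!)`** (`ṽ₁ = 5`, `ṽ₂ = 1897/36`; equal to `v₂(u_m)` of Zudilin's first recursion). -/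
theorem padicValRat_two_vT_succ (m : ℕ) :
    padicValRat 2 (vT (m + 1)) = -(2 * (m : ℤ)) - 2 * padicValNat 2 m.factorial := by
  have h5 : padicValRat 2 (5 : ℚ) = 0 := by
    rw [show (5 : ℚ) = ((5 : ℤ) : ℚ) by norm_num, padicValRat_two_oddInt 5 ⟨2, by norm_num⟩]
  have h2 : padicValRat 2 (vT 2) = 0 - 2 := by
    rw [vT_two, padicValRat.div (by norm_num) (by norm_num), show (1897 : ℚ) = ((1897 : ℤ) : ℚ) by norm_num,
      padicValRat_two_oddInt 1897 ⟨948, by norm_num⟩, show (36 : ℚ) = 2 ^ 2 * ((9 : ℤ) : ℚ) by norm_num,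
      padicValRat.mul (by norm_num) (by norm_num), padicValRat.pow, padicValRat_two_two',
      padicValRat_two_oddInt 9 ⟨4, by norm_num⟩]
    norm_num
  have h := padicValRat_solT_succ (-1) 5 0 vT_succ_pos h5 h2 m
  rw [show vT (m + 1) = solT (-1) 5 (m + 1) from rfl, h]
  ring

/-! ### Digit-sum form, the `2`-part of `den ṽ_n`, and the `2`-part of the inclusion (14) -/

/-- **`v₂(ṽ_n) = 4 − 4n + 2s₂(n−1)` for `n ≥ 1`** (Legendre: `v₂(m!) = m − s₂(m)`). -/
theorem padicValRat_vT {n : ℕ} (hn : 1 ≤ n) :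
    padicValRat 2 (vT n) = 4 - 4 * (n : ℤ) + 2 * ((Nat.digits 2 (n - 1)).sum : ℤ) := by
  obtain ⟨m, rfl⟩ : ∃ m, n = m + 1 := ⟨n - 1, by omega⟩
  rw [padicValRat_two_vT_succ, show m + 1 - 1 = m from rfl]
  have h := sub_one_mul_padicValNat_factorial (p := 2) m
  norm_num at h
  have hle := Nat.digit_sum_le 2 m
  omega

/-- Companion digit-sum form for `ũ`: `v₂(ũ_n) = 5 − 4n + 2s₂(n−1)` for `n ≥ 1`, by the recursion route (a second proof of
`CatalanRemarksUTDenominator.padicValRat_uT`, which goes through the box identification). -/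
theorem padicValRat_uT_rec {n : ℕ} (hn : 1 ≤ n) :
    padicValRat 2 (uT n) = 5 - 4 * (n : ℤ) + 2 * ((Nat.digits 2 (n - 1)).sum : ℤ) := by
  obtain ⟨m, rfl⟩ : ∃ m, n = m + 1 := ⟨n - 1, by omega⟩
  rw [padicValRat_two_uT_succ, show m + 1 - 1 = m from rfl]
  have h := sub_one_mul_padicValNat_factorial (p := 2) m
  norm_num at h
  have hle := Nat.digit_sum_le 2 m
  omega

/-- A rational with nonnegative `2`-adic valuation has odd reduced denominator. -/
theorem den_odd_of_padicValRat_two_nonneg (r : ℚ) (h : 0 ≤ padicValRat 2 r) : Odd r.den := by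
  by_contra hne
  have hd : 2 ∣ r.den := even_iff_two_dvd.mp (Nat.not_odd_iff_even.mp hne)
  have hcop : Nat.Coprime r.num.natAbs r.den := r.reduced
  have hnd : ¬ (2 : ℤ) ∣ r.num := by
    intro h2
    have h2' : 2 ∣ r.num.natAbs := by omega
    exact absurd ((Nat.Coprime.coprime_dvd_left h2' hcop).eq_one_of_dvd hd) (by norm_num)
  have hv : padicValNat 2 r.den ≠ 0 := (dvd_iff_padicValNat_ne_zero r.den_nz).mp hd
  rw [padicValRat_def, padicValInt.eq_zero_of_not_dvd hnd] at h
  omega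

/-- **The `2`-part of `den ṽ_n` is exactly `2^{4n−4−2s₂(n−1)}`** (`n ≥ 1`): `v₂(den ṽ_n) = 4n − 4 − 2s₂(n−1)`. -/
theorem padicValNat_two_den_vT {n : ℕ} (hn : 1 ≤ n) :
    padicValNat 2 (vT n).den = 4 * n - 4 - 2 * (Nat.digits 2 (n - 1)).sum := by
  have hv := padicValRat_vT hn
  rw [padicValRat_def] at hv
  have hle : (Nat.digits 2 (n - 1)).sum ≤ n - 1 := Nat.digit_sum_le 2 (n - 1)
  by_cases hd : 2 ∣ (vT n).den
  · have hcop : Nat.Coprime (vT n).num.natAbs (vT n).den := (vT n).reduced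
    have hnd : ¬ (2 : ℤ) ∣ (vT n).num := by
      intro h2
      have h2' : 2 ∣ (vT n).num.natAbs := by omega
      exact absurd ((Nat.Coprime.coprime_dvd_left h2' hcop).eq_one_of_dvd hd) (by norm_num)
    rw [padicValInt.eq_zero_of_not_dvd hnd] at hv
    omega
  · rw [padicValNat.eq_zero_of_not_dvd hd] at hv ⊢
    omega

/-- **The `2`-part of the `ṽ`-inclusion (14) of [Zudilin 2002, Thm 2], sharp in the exponent of `2`:** for every `n ≥ 1`,
`2^{4n−4} ṽ_n` has ODD reduced denominator (`v₂(2^{4n−4} ṽ_n) = 2s₂(n−1) ≥ 0`).  Print: `2^{4n+o(n)} D²_{2n−1} ṽ_n ∈ ℤ`; the odd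
part `D²_{2n−1}` is not treated here. -/
theorem vT_twoPart_odd_den {n : ℕ} (hn : 1 ≤ n) : Odd (2 ^ (4 * n - 4) * vT n).den := by
  apply den_odd_of_padicValRat_two_nonneg
  obtain ⟨m, rfl⟩ : ∃ m, n = m + 1 := ⟨n - 1, by omega⟩
  have hq : vT (m + 1) ≠ 0 := (vT_succ_pos m).ne'
  rw [padicValRat.mul (pow_ne_zero _ two_ne_zero) hq, padicValRat.pow, padicValRat_two_two',
    padicValRat_vT (by omega)]
  omega

/-- **Part C (bundled):** for `n ≥ 1`, `ṽ_n > 0`, `v₂(ṽ_n) = 4 − 4n + 2s₂(n−1)`, the `2`-part of `den ṽ_n` is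
`2^{4n−4−2s₂(n−1)}`, and `2^{4n−4} ṽ_n` has odd denominator. -/
theorem vT_twoAdic {n : ℕ} (hn : 1 ≤ n) :
    0 < vT n ∧ padicValRat 2 (vT n) = 4 - 4 * (n : ℤ) + 2 * ((Nat.digits 2 (n - 1)).sum : ℤ) ∧
      padicValNat 2 (vT n).den = 4 * n - 4 - 2 * (Nat.digits 2 (n - 1)).sum ∧ Odd (2 ^ (4 * n - 4) * vT n).den := by
  obtain ⟨m, rfl⟩ : ∃ m, n = m + 1 := ⟨n - 1, by omega⟩
  exact ⟨vT_succ_pos m, padicValRat_vT hn, padicValNat_two_den_vT hn, vT_twoPart_odd_den hn⟩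

/-- Sanity by name: the `2`-part of `den ṽ₃` is `2⁶` (`ṽ₃ = 903093/1600`, `1600 = 2⁶·25`; `4·3 − 4 − 2s₂(2) = 6`). -/
example : padicValNat 2 (vT 3).den = 6 := by
  rw [padicValNat_two_den_vT (by norm_num)]
  norm_num

end Summit.KontsevichZagierPeriods.Zeta5Search.CatalanRemarksTwoAdic
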